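import Summits.HodgeConjecture.CorCM.MultiFieldWeilNonIsomorphicMenu
import HarnessLib

/-!
# MULTI-FIELD WEIL ENGINE — SEXTIC AND OCTIC TWIN PAIRS INSIDE THE MENU: `E` + pairs `B_m ≁ B_{tw m}` of SIMPLE CM threefolds over ONE sextic field each, or of CM
# fourfolds of `k`-signature `(1,3)` over ONE `𝔄₄`/`𝔖₄`-octic field each + further simple threefolds, simple fourfolds, `(2,3)`/`(3,2)` fivefolds, all through `k`, the fields
# PAIRWISE NON-ISOMORPHIC within each degree — the Hodge conjecture for every product of copies, given only Markman's fourfold and hyperbolic-sixfold theorems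

Cell `pub-hodgecm2` (COR-CM), seat b30 gen 39 (2026-08-25); count-neutral own lane MULTI-FIELD WEIL ENGINE (stem `MultiFieldWeil*`), sequel of T3c
(`CorCM/MultiFieldWeilTwinsMenu.lean`: SEXTIC twin pairs inside the menu) on top of T2c (`CorCM/MultiFieldWeilTwinsKindRealised.lean`: the frames headline with several twin pairs of
ANY size `≥ 3`) and of `CorCM/MultiFieldWeilNonIsomorphicMenu.lean` (the menu with `Hom = ∅` in every degree; the 𝔖₄ lemma).  Theorems only; no definition, no named fact, no `sorry`.
HONEST FRAMING: conditional ONLY on the two displayed Markman binders; `HC_CM` is NOT proved and not asserted.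

WHAT IS NEW (RUNBOOK-g38 frontier F5, «ISOMORPHIC octic fields with several types inside a multi-field family»).  T2c's census allows a twin pair on ANY slot size `≥ 3` with
ONE-member position sets and `2`-transitive diagonal image; T3c realised it only for SEXTIC fields, reading the two types through a dihedral frame.  Here every index carries a
SIGN frame (`exists_signFrame`), the two types of a doubled index are read at their position singletons `{q_m}`, `{q_{tw m}}` (distinct by Shimura's criterion,
`DihedralSexticPair.cmType_ne_and_ne_compl_of_not_isIsogenous`), and the `2`-transitivity of `Aut(ℂ/τk)` on the `τ`-embeddings is: for a doubled OCTIC index the degree-`24`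
hypothesis of the menu (Z4); for a doubled SEXTIC index DERIVED from non-isogeny and simplicity (§1 `twoTransitive_aut_of_sextic_twins`: the field is not Galois —
`SexticCMThreefoldPair.not_isGalois_of_isSimple_of_not_isIsogenous` — so its dihedral frame carries the six affine maps of `ℤ/3`; the statement is frame-free).  So:

**`hodgeConjectureFor_biproduct_comp_of_twinsMenu_octic`.**  Slots `is : Fin r → I` over CM fields `Kf i ⊇ iK i (k)`, `k = Kf i₀` imaginary quadratic, sizes
`n_m = nI (is m) ∈ {3, 4, 5}`; an involution `tw` of `Fin r` whose `2`-element fibres share their index and are SEXTIC OR OCTIC; `E = A 0 ⊨ (k; {τ})`, `B_m = A (m+1) ⊨ (K_m; Φ (m+1))`.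
HYPOTHESES: `B_m` SIMPLE for `n_m ∈ {3, 4}`, of `k`-signature `(2,3)` ∕ `(3,2)` for `n_m = 5`, of `k`-signature `(1,3)` ∕ `(3,1)` for a doubled OCTIC slot; twins NON-ISOGENOUS; every
octic field with two `τ`-embeddings generating degree `24` with `τ(k)`; `Hom(K_m, K_{m₀}) = ∅` for `m₀ ≠ m` in DIFFERENT units of EQUAL degree; for `K_{m₀}` octic and `K_m` sextic
a `τ`-embedding of `K_m` with a value outside `L(K_{m₀})`.  THEN the Hodge conjecture holds for EVERY product of copies `⨁_j A(κ j)`, GIVEN ONLY Markman's two theorems.  In words: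
over one imaginary quadratic `k` — simple CM threefolds with AT MOST TWO isogeny classes per sextic field, CM fourfolds of `k`-signature `(1,3)` with AT MOST TWO isogeny classes
per `𝔄₄`/`𝔖₄`-octic field (or ONE class of any simple fourfold), `(2,3)`/`(3,2)` fivefolds one class per decic field, fields pairwise non-isomorphic within each degree.
NOT covered, honestly: a third class per field; `(2,2)`-twins; decic twins (two-member types); octic fields with imprimitive quartic part (see `…ClosureDisjointSlots`).

[cite: Markman2025SurveySecant, Thm. 1.2] [cite: Markman2025SecantWeil, Thm 1.5.1] [cite: Shimura1998, §6.1 Corollary of Theorem 2, §8.2 Prop. 26, §8.4, §18.2 Lemma (i)]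
[cite: Deligne1982HodgeCycles, §5 (b)] [cite: Lang2002, VI §1 Thm. 1.14 and V §2 Thm. 2.8] [cite: MoonenZarhin1995Duke, Thm. 2.4] [cite: Pohlmann1968, Thm 1]
[cite: DixonMortimer1996, §1.4 Ex. 1.4.1–1.4.2; §1.6, Thm. 1.6A; §2.1; §3.3, Thm. 3.3A] [cite: Dodson1984, §1.1 Imprimitivity Theorem and §5.1.2 Theorem] [cite: MumfordAV1970, §19]

## References
* [Markman2025SurveySecant] E. Markman, arXiv:2509.23403, Thm. 1.2.  [Markman2025SecantWeil] E. Markman, Cycles on abelian 2n-folds of Weil type from secant sheaves on abelian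
  n-folds, Thm 1.5.1.  [Shimura1998] G. Shimura, *Abelian varieties with complex multiplication and modular functions*, §6.1, §8.2, §8.4, §18.2.  [Deligne1982HodgeCycles]
  P. Deligne, LNM 900, §5 (b).  [Lang2002] S. Lang, *Algebra*, GTM 211, V §2, VI §1.  [MoonenZarhin1995Duke] B. Moonen, Yu. Zarhin, Duke Math. J. 77 (1995), Thm. 2.4.
  [Pohlmann1968] H. Pohlmann, Ann. of Math. 88 (1968), Thm 1.  [DixonMortimer1996] J. D. Dixon, B. Mortimer, *Permutation Groups*, GTM 163.  [Dodson1984] B. Dodson, Trans. AMS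
  283 (1984).  [MumfordAV1970] D. Mumford, *Abelian Varieties*, §19.
-/

noncomputable section

open CategoryTheory CategoryTheory.Limits NumberField IntermediateField

namespace Summit.HodgeConjecture.CorCM.MultiFieldWeil

open Finset
open Literature.AlgebraicGeometry Literature.AlgebraicGeometry.Motives Literature.AlgebraicGeometry.HodgeTheory
open Literature.AlgebraicGeometry.ComplexMultiplication (IsCMTypeRealisation)
open Literature.AlgebraicTopology.SingularHomology
open Literature.NumberTheory.ComplexMultiplication
open Summit.HodgeConjecture.CorCM.Census.MultiFieldWeil

open scoped Classical

/-! ## §1 Sextic twins: `2`-transitivity of `Aut(ℂ/τk)` on the `τ`-embeddings, frame-free -/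

section SexticTwins

variable {k K : Type} [Field k] [NumberField k] [IsCMField k] [Field K] [NumberField K] [IsCMField K]

/-- **TWO NON-ISOGENOUS SIMPLE THREEFOLDS OVER ONE SEXTIC FIELD MAKE `Aut(ℂ/τk)` `2`-TRANSITIVE ON ITS `τ`-EMBEDDINGS.**  `K ⊇ i(k)` sextic, `k` imaginary quadratic, `B₀ ⊨ (K; Φ₀)`,
`B₁ ⊨ (K; Φ₁)` SIMPLE, NON-ISOGENOUS, each type with ONE member over `τ`.  Then any two pairs of distinct `τ`-embeddings of `K` are interchanged by an automorphism of `ℂ` over `τ(k)`: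
`K` is not Galois (T3c's input `SexticCMThreefoldPair.not_isGalois_of_isSimple_of_not_isIsogenous`), so its dihedral frame (`DihedralSexticPair.exists_frame_of_card_fibre_eq_one`) realises
the six affine maps `x ↦ ±x + j` of `ℤ/3`, which are `2`-transitive (`exists_affine_zmod3`). [cite: Shimura1998, §6.1 Corollary of Theorem 2, §8.4, §18.2 Lemma (i)]
[cite: Lang2002, VI §1 Thm. 1.14] [cite: DixonMortimer1996, §2.1] -/
theorem twoTransitive_aut_of_sextic_twins (h6 : Module.finrank ℚ K = 6) (h2 : Module.finrank ℚ k = 2) (i : k →+* K) (τ : k →+* ℂ)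
    {Φ₀ Φ₁ : CMType K} {A₀ : AbelianVariety ℂ} {ι₀ : 𝓞 K →+* End A₀} {θ₀ : K →+* Module.End ℂ (complexBetti A₀.X 1)}
    {A₁ : AbelianVariety ℂ} {ι₁ : 𝓞 K →+* End A₁} {θ₁ : K →+* Module.End ℂ (complexBetti A₁.X 1)}
    (hA₀ : IsCMTypeRealisation Φ₀ A₀ ι₀ θ₀) (hA₁ : IsCMTypeRealisation Φ₁ A₁ ι₁ θ₁) (hS₀ : A₀.IsSimple) (hS₁ : A₁.IsSimple) (hni : ¬ AbelianVariety.IsIsogenous A₀ A₁)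
    (hone₀ : (Finset.univ.filter fun s : K →+* ℂ => s.comp i = τ ∧ s ∈ Φ₀.1).card = 1)
    (hone₁ : (Finset.univ.filter fun s : K →+* ℂ => s.comp i = τ ∧ s ∈ Φ₁.1).card = 1)
    (s₁ s₂ s₁' s₂' : K →+* ℂ) (hs₁ : s₁.comp i = τ) (hs₂ : s₂.comp i = τ) (hs₁' : s₁'.comp i = τ) (hs₂' : s₂'.comp i = τ) (h₁₂ : s₁ ≠ s₂) (h₁₂' : s₁' ≠ s₂') :
    ∃ ρ : ℂ ≃+* ℂ, (ρ : ℂ →+* ℂ).comp τ = τ ∧ (ρ : ℂ →+* ℂ).comp s₁ = s₁' ∧ (ρ : ℂ →+* ℂ).comp s₂ = s₂' := by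
  have hττ : ComplexEmbedding.conjugate τ ≠ τ := QuarticCM.conjugate_ne τ
  have hdich : ∀ s : K →+* ℂ, s.comp i = τ ∨ s.comp i = ComplexEmbedding.conjugate τ := fun s => QuarticCM.eq_or_eq_conjugate_of_quadratic h2 τ (s.comp i)
  have hK : ¬ IsGalois ℚ K := SexticCMThreefoldPair.not_isGalois_of_isSimple_of_not_isIsogenous h6 h2 i hA₀ hA₁ hS₀ hS₁ hni
  have hne : Φ₀.1 ≠ Φ₁.1 := (DihedralSexticPair.cmType_ne_and_ne_compl_of_not_isIsogenous hA₀ hA₁ hni).1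
  let Φ₂ : Fin 2 → CMType K := Fin.cons Φ₀ fun _ => Φ₁
  have hone : ∀ j : Fin 2, (Finset.univ.filter fun s : K →+* ℂ => s.comp i = τ ∧ s ∈ (Φ₂ j).1).card = 1 := Fin.forall_fin_two.2 ⟨hone₀, hone₁⟩
  have hne₂ : (Φ₂ 0).1 ≠ (Φ₂ 1).1 := hne
  obtain ⟨E, -, he_sign', he_gal, -⟩ := DihedralSexticPair.exists_frame_of_card_fibre_eq_one hττ hdich hK h6 (Φ := Φ₂) hone hne₂
  have he_sign : ∀ s : K →+* ℂ, (E s).2 = true ↔ s.comp i = τ := fun s => (he_sign' s).symm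
  have hsymm : ∀ s : K →+* ℂ, s.comp i = τ → E.symm ((E s).1, true) = s := fun s hs => by
    rw [show ((E s).1, true) = E s from Prod.ext rfl ((he_sign s).2 hs).symm, Equiv.symm_apply_apply]
  have hne_pos : ∀ s t : K →+* ℂ, s.comp i = τ → t.comp i = τ → s ≠ t → (E s).1 ≠ (E t).1 := fun s t hs ht hst h =>
    hst (by rw [← hsymm s hs, ← hsymm t ht, h])
  obtain ⟨j, f, hb, hb'⟩ := exists_affine_zmod3 (E s₁).1 (E s₂).1 (E s₁').1 (E s₂').1 (hne_pos _ _ hs₁ hs₂ h₁₂) (hne_pos _ _ hs₁' hs₂' h₁₂')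
  obtain ⟨σ, hσ⟩ := he_gal j f
  have hmove : ∀ s : K →+* ℂ, s.comp i = τ → (σ : ℂ →+* ℂ).comp s = E.symm ((if f then -(E s).1 else (E s).1) + j, true) := fun s hs => by
    have h := hσ s
    rw [(he_sign s).2 hs] at h
    rw [← h, Equiv.symm_apply_apply]
  refine ⟨σ, ?_, ?_, ?_⟩
  · have hτ' : (E.symm ((if f then -(E s₁).1 else (E s₁).1) + j, true)).comp i = τ := (he_sign _).1 (by rw [Equiv.apply_symm_apply])
    calc (σ : ℂ →+* ℂ).comp τ = ((σ : ℂ →+* ℂ).comp s₁).comp i := by rw [RingHom.comp_assoc, hs₁]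
      _ = τ := by rw [hmove s₁ hs₁, hτ']
  · rw [hmove s₁ hs₁, hb, hsymm s₁' hs₁']
  · rw [hmove s₂ hs₂, hb', hsymm s₂' hs₂']

end SexticTwins

/-! ## §2 The twins menu with sextic and octic twin pairs -/

section TwinsMenu

variable {I : Type} {r : ℕ} {Kf : I → Type} [∀ i, Field (Kf i)] [∀ i, NumberField (Kf i)] [∀ i, IsCMField (Kf i)]
  {i₀ : I} {is : Fin r → I} {τ : Kf i₀ →+* ℂ}
  {A : Fin (r + 1) → AbelianVariety ℂ} {Φ : ∀ j : Fin (r + 1), CMType (Kf (mfSlots i₀ is j))}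
  {ι : ∀ j, 𝓞 (Kf (mfSlots i₀ is j)) →+* End (A j)}
  {θ : ∀ j, Kf (mfSlots i₀ is j) →+* Module.End ℂ (complexBetti (A j).X 1)}

/-- **SEXTIC AND OCTIC TWIN PAIRS INSIDE THE NON-ISOMORPHIC MENU — GIVEN ONLY MARKMAN'S FOURFOLD AND HYPERBOLIC-SIXFOLD THEOREMS.**  See the module docstring.  `HC_CM` is NOT
asserted. [cite: Markman2025SurveySecant, Thm. 1.2] [cite: Markman2025SecantWeil, Thm 1.5.1] [cite: Shimura1998, §6.1 Corollary of Theorem 2, §8.2 Prop. 26, §18.2]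
[cite: Deligne1982HodgeCycles, §5 (b)] [cite: DixonMortimer1996, §1.4 Ex. 1.4.1–1.4.2; §1.6, Thm. 1.6A; §2.1; §3.3, Thm. 3.3A] [cite: Dodson1984, §1.1 Imprimitivity Theorem and §5.1.2 Theorem] -/
theorem hodgeConjectureFor_biproduct_comp_of_twinsMenu_octic (hW4 : Markman2025_weilClasses_algebraic_abelianFourfold)
    (hM6 : Markman2025_weilClasses_algebraic_hyperbolicSixfold) {N : ℕ} (κ : Fin N → Fin (r + 1)) (h2 : Module.finrank ℚ (Kf i₀) = 2) (nI : I → ℕ)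
    (hnI : ∀ m : Fin r, nI (is m) = 3 ∨ nI (is m) = 4 ∨ nI (is m) = 5) (hdeg : ∀ m : Fin r, Module.finrank ℚ (Kf (is m)) = 2 * nI (is m))
    (iK : ∀ i : I, Kf i₀ →+* Kf i) (hA : ∀ j, IsCMTypeRealisation (Φ j) (A j) (ι j) (θ j)) (hΨ : ∀ σ : Kf i₀ →+* ℂ, σ ∈ (Φ 0).1 ↔ σ = τ)
    (tw : Fin r → Fin r) (htw : ∀ m, tw (tw m) = m) (hι : ∀ m, is (tw m) = is m) (htw34 : ∀ m, tw m ≠ m → nI (is m) = 3 ∨ nI (is m) = 4)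
    (hS : ∀ m : Fin r, nI (is m) = 3 ∨ nI (is m) = 4 → (A m.succ).IsSimple)
    (h23 : ∀ m : Fin r, nI (is m) = 5 → (Finset.univ.filter fun s : Kf (is m) →+* ℂ => s.comp (iK (is m)) = τ ∧ s ∈ (Φ m.succ).1).card = 2 ∨
      (Finset.univ.filter fun s : Kf (is m) →+* ℂ => s.comp (iK (is m)) = τ ∧ s ∈ (Φ m.succ).1).card = 3)
    (h13 : ∀ m : Fin r, tw m ≠ m → nI (is m) = 4 → (Finset.univ.filter fun s : Kf (is m) →+* ℂ => s.comp (iK (is m)) = τ ∧ s ∈ (Φ m.succ).1).card = 1 ∨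
      (Finset.univ.filter fun s : Kf (is m) →+* ℂ => s.comp (iK (is m)) = τ ∧ s ∈ (Φ m.succ).1).card = 3)
    (hni : ∀ m, tw m ≠ m → ¬ AbelianVariety.IsIsogenous (A m.succ) (A (tw m).succ))
    (h24 : ∀ m : Fin r, nI (is m) = 4 → ∃ s₀ t₀ : Kf (is m) →+* ℂ, s₀.comp (iK (is m)) = τ ∧ t₀.comp (iK (is m)) = τ ∧ s₀ ≠ t₀ ∧
      Module.finrank ℚ ↥(adjoin ℚ (Set.range τ) ⊔ adjoin ℚ (Set.range s₀ ∪ Set.range t₀)) = 24)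
    (hiso : ∀ m₀ m : Fin r, m₀ ≠ m → tw m₀ ≠ m → nI (is m₀) = nI (is m) → IsEmpty (Kf (is m) →+* Kf (is m₀)))
    (hout43 : ∀ m₀ m : Fin r, m₀ ≠ m → nI (is m₀) = 4 → nI (is m) = 3 →
      ∃ s : Kf (is m) →+* ℂ, s.comp (iK (is m)) = τ ∧ ∃ x, s x ∉ normalClosure ℚ (Kf (is m₀)) ℂ) :
    HodgeConjectureFor (⨁ fun j => A (κ j)).dim (⨁ fun j => A (κ j)).X := by
  have hττ : ComplexEmbedding.conjugate τ ≠ τ := QuarticCM.conjugate_ne τ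
  have hk : ∀ σ : Kf i₀ →+* ℂ, σ = τ ∨ σ = ComplexEmbedding.conjugate τ := fun σ => QuarticCM.eq_or_eq_conjugate_of_quadratic h2 τ σ
  obtain ⟨δ₀, d, hd, hδ₀⟩ := CyclicSextic.exists_sq_eq_neg_nat_of_isTotallyComplex (Kf i₀) h2
  obtain ⟨δ, hδ, hτ⟩ := OcticCurveFourfold.exists_delta_of_mem h2 hd hδ₀ τ
  let im : ∀ m : Fin r, Kf i₀ →+* Kf (is m) := fun m => iK (is m)
  have hn : ∀ m, nI (is (tw m)) = nI (is m) := fun m => congrArg nI (hι m)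
  -- (0) transports across an equality of indices, by substitution
  have homT : ∀ i j : I, i = j → Nonempty (Kf i →+* Kf j) := fun i j h => by subst h; exact ⟨RingHom.id _⟩
  have castT : ∀ i j : I, i = j → ∀ (Ψ : CMType (Kf i)) (B : AbelianVariety ℂ) (ιB : 𝓞 (Kf i) →+* End B)
      (θB : Kf i →+* Module.End ℂ (complexBetti B.X 1)), IsCMTypeRealisation Ψ B ιB θB →
      ∃ (Ψ₂ : CMType (Kf j)) (ι₂ : 𝓞 (Kf j) →+* End B) (θ₂ : Kf j →+* Module.End ℂ (complexBetti B.X 1)), HEq Ψ₂ Ψ ∧ IsCMTypeRealisation Ψ₂ B ι₂ θ₂ := by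
    intro i j h; subst h; exact fun Ψ B ιB θB hB => ⟨Ψ, ιB, θB, HEq.rfl, hB⟩
  have countT : ∀ i j : I, i = j → ∀ (Ψ : CMType (Kf i)) (Ψ₂ : CMType (Kf j)), HEq Ψ₂ Ψ →
      (Finset.univ.filter fun s : Kf i →+* ℂ => s.comp (iK i) = τ ∧ s ∈ Ψ.1).card = 1 →
      (Finset.univ.filter fun s : Kf j →+* ℂ => s.comp (iK j) = τ ∧ s ∈ Ψ₂.1).card = 1 := by
    intro i j h; subst h; intro Ψ Ψ₂ hh; cases hh; exact id
  -- (1) the normalised counts and structures: threefolds `1`, fourfolds `1` or `2`, fivefolds `2`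
  have hex : ∀ m : Fin r, ∃ pm : ℕ, pm ≤ nI (is m) ∧ ((nI (is m) = 3 ∧ pm = 1) ∨ (nI (is m) = 4 ∧ pm = 1) ∨ (nI (is m) = 4 ∧ pm = 2) ∨ (nI (is m) = 5 ∧ pm = 2)) ∧
      ((Finset.univ.filter fun s : Kf (is m) →+* ℂ => s.comp (im m) = τ ∧ s ∈ (Φ m.succ).1).card = pm ∨
        (Finset.univ.filter fun s : Kf (is m) →+* ℂ => s.comp (im m) = τ ∧ s ∈ (Φ m.succ).1).card = nI (is m) - pm) := fun m => by
    rcases hnI m with h | h | h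
    · refine ⟨1, by rw [h]; norm_num, Or.inl ⟨h, rfl⟩, ?_⟩
      rcases card_filter_mem_eq_one_or_two_of_isSimple (by rw [hdeg m, h]) h2 (im m) (hA m.succ) (hS m (Or.inl h)) τ with hc | hc
      · exact Or.inl hc
      · exact Or.inr (hc.trans (by rw [h] : nI (is m) - 1 = 2).symm)
    · rcases card_filter_mem_octic_of_isSimple (by rw [hdeg m, h]) h2 (im m) (hA m.succ) (hS m (Or.inr h)) τ with hc | hc | hc
      · exact ⟨1, by rw [h]; norm_num, Or.inr (Or.inl ⟨h, rfl⟩), Or.inl hc⟩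
      · exact ⟨2, by rw [h]; norm_num, Or.inr (Or.inr (Or.inl ⟨h, rfl⟩)), Or.inl hc⟩
      · exact ⟨1, by rw [h]; norm_num, Or.inr (Or.inl ⟨h, rfl⟩), Or.inr (hc.trans (by rw [h] : nI (is m) - 1 = 3).symm)⟩
    · refine ⟨2, by rw [h]; norm_num, Or.inr (Or.inr (Or.inr ⟨h, rfl⟩)), ?_⟩
      rcases h23 m h with hc | hc
      · exact Or.inl hc
      · exact Or.inr (hc.trans (by rw [h] : nI (is m) - 2 = 3).symm)
  choose p hpn hnp hor using hex
  obtain ⟨Φ', ι', θ', hA', h0, hp⟩ := exists_realisations_card_eq_of_or (n := fun m => nI (is m)) (Φ := Φ) h2 hdeg im hA p hpn hor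
  have hΨ' : ∀ σ : Kf i₀ →+* ℂ, σ ∈ (Φ' 0).1 ↔ σ = τ := by rw [h0]; exact hΨ
  have hp1 : ∀ m, tw m ≠ m → p m = 1 := fun m htm => by
    rcases hnp m with ⟨-, h⟩ | ⟨-, h⟩ | ⟨h4, h⟩ | ⟨h5, -⟩
    · exact h
    · exact h
    · exfalso
      rcases hor m with hc | hc <;> rcases h13 m htm h4 with h1 | h3 <;> rw [hc] at * <;> omega
    · rcases htw34 m htm with h | h <;> omega
  have h1 : ∀ m, tw m ≠ m → (Finset.univ.filter fun s : Kf (is m) →+* ℂ => s.comp (im m) = τ ∧ s ∈ (Φ' m.succ).1).card = 1 := fun m htm => by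
    rw [hp m, hp1 m htm]
  have slotT : ∀ a b : Fin r, a = b → HEq (Φ' a.succ) (Φ' b.succ) := fun a b h => by subst h; exact HEq.rfl
  -- (2) two slots with a common index lie in one unit
  have hexs : ∀ m : Fin r, ∃ s : Kf (is m) →+* ℂ, s.comp (im m) = τ := fun m => by
    have hc := SexticOcticWeil.card_filter_comp_eq_of_finrank (n := nI (is m)) (im m) (hdeg m) h2 τ
    obtain ⟨s, hs⟩ := Finset.card_pos.1 (by rw [hc]; rcases hnI m with h | h | h <;> rw [h] <;> norm_num)
    exact ⟨s, (Finset.mem_filter.1 hs).2⟩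
  have hunit : ∀ m₀ m : Fin r, is m = is m₀ → m = m₀ ∨ m = tw m₀ := by
    intro m₀ m h
    by_contra hne
    push Not at hne
    exact (hiso m₀ m (Ne.symm hne.1) (Ne.symm hne.2) (by rw [h])).false (Classical.choice (homT _ _ h))
  have hn0 : ∀ m, 0 < nI (is m) := fun m => by rcases hnI m with h | h | h <;> rw [h] <;> norm_num
  -- (3) ONE SIGN FRAME PER INDEX
  have hfr : ∀ (i : I) (ni : ℕ), Module.finrank ℚ (Kf i) = 2 * ni → ∃ E : (Kf i →+* ℂ) ≃ Fin ni × Bool,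
      (∀ s, (E s).2 = true ↔ s.comp (iK i) = τ) ∧ ∀ s, E (ComplexEmbedding.conjugate s) = ((E s).1, !(E s).2) := fun i ni hdi => exists_signFrame hdi h2 (iK i) hττ hk
  choose E hE_sign hE_conj using hfr
  have readT : ∀ i j : I, ∀ h : i = j, ∀ (hi : Module.finrank ℚ (Kf i) = 2 * nI i) (hj : Module.finrank ℚ (Kf j) = 2 * nI j) (Ψ : CMType (Kf i)) (Ψ₂ : CMType (Kf j))
      (qi : Fin (nI i)) (qj : Fin (nI j)), (qi : ℕ) = (qj : ℕ) →
      HEq Ψ₂ Ψ → (∀ s, s ∈ Ψ₂.1 ↔ (E j (nI j) hj s).2 = decide ((E j (nI j) hj s).1 ∈ ({qj} : Finset (Fin (nI j))))) →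
      ∀ s, s ∈ Ψ.1 ↔ (E i (nI i) hi s).2 = decide ((E i (nI i) hi s).1 ∈ ({qi} : Finset (Fin (nI i)))) := by
    intro i j h; subst h
    intro hi hj Ψ Ψ₂ qi qj hq hh hr
    have hΨ : Ψ₂ = Ψ := eq_of_heq hh
    subst hΨ
    have hqq : qj = qi := Fin.ext hq.symm
    subst hqq
    exact hr
  have diagT : ∀ i j : I, ∀ h : i = j, ∀ (hi : Module.finrank ℚ (Kf i) = 2 * nI i) (hj : Module.finrank ℚ (Kf j) = 2 * nI j) (ρ : ℂ →+* ℂ)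
      (a : Fin (nI i)) (x : Fin (nI i)) (y : Fin (nI j)),
      ρ.comp ((E i (nI i) hi).symm (a, true)) = (E i (nI i) hi).symm (x, true) →
      ρ.comp ((E j (nI j) hj).symm (Fin.cast (congrArg nI h) a, true)) = (E j (nI j) hj).symm (y, true) → Fin.cast (congrArg nI h) x = y := by
    intro i j h; subst h
    intro hi hj ρ a x y h₁ h₂
    have ha : Fin.cast (congrArg nI (rfl : i = i)) a = a := Fin.ext rfl
    rw [ha] at h₂
    exact (Fin.ext rfl : Fin.cast _ x = x).trans (Prod.mk.inj ((E i (nI i) hi).symm.injective (h₁.symm.trans h₂))).1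
  have autT : ∀ i j : I, i = j →
      (∀ s₁ s₂ s₁' s₂' : Kf i →+* ℂ, s₁.comp (iK i) = τ → s₂.comp (iK i) = τ → s₁'.comp (iK i) = τ → s₂'.comp (iK i) = τ → s₁ ≠ s₂ → s₁' ≠ s₂' →
        ∃ ρ : ℂ ≃+* ℂ, (ρ : ℂ →+* ℂ).comp τ = τ ∧ (ρ : ℂ →+* ℂ).comp s₁ = s₁' ∧ (ρ : ℂ →+* ℂ).comp s₂ = s₂') →
      ∀ s₁ s₂ s₁' s₂' : Kf j →+* ℂ, s₁.comp (iK j) = τ → s₂.comp (iK j) = τ → s₁'.comp (iK j) = τ → s₂'.comp (iK j) = τ → s₁ ≠ s₂ → s₁' ≠ s₂' →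
        ∃ ρ : ℂ ≃+* ℂ, (ρ : ℂ →+* ℂ).comp τ = τ ∧ (ρ : ℂ →+* ℂ).comp s₁ = s₁' ∧ (ρ : ℂ →+* ℂ).comp s₂ = s₂' := by
    intro i j h; subst h; exact id
  -- (4) the frames of the slots, their readings and position sets
  let e : ∀ m : Fin r, (Kf (is m) →+* ℂ) ≃ Fin (nI (is m)) × Bool := fun m => E (is m) (nI (is m)) (hdeg m)
  have he_sign : ∀ (m : Fin r) (s : Kf (is m) →+* ℂ), (e m s).2 = true ↔ s.comp (im m) = τ := fun m => hE_sign (is m) (nI (is m)) (hdeg m)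
  have he_conj : ∀ (m : Fin r) (s : Kf (is m) →+* ℂ), e m (ComplexEmbedding.conjugate s) = ((e m s).1, !(e m s).2) := fun m => hE_conj (is m) (nI (is m)) (hdeg m)
  let P : ∀ m : Fin r, Finset (Fin (nI (is m))) := fun m => Finset.univ.filter fun a : Fin (nI (is m)) => (e m).symm (a, true) ∈ (Φ' m.succ).1
  have hΦ : ∀ (m : Fin r) (s : Kf (is m) →+* ℂ), s ∈ (Φ' m.succ).1 ↔ (e m s).2 = decide ((e m s).1 ∈ P m) := fun m s =>
    mem_iff_snd_eq_decide_mem_posSet (he_conj m) (Φ' m.succ) s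
  have hcard : ∀ m : Fin r, (P m).card = p m := fun m => (card_posSet (he_sign m) (Φ' m.succ)).trans (hp m)
  -- the twin positions: the unique member of the singleton position set
  have hsing : ∀ m, tw m ≠ m → ∃ a, P m = {a} := fun m htm => Finset.card_eq_one.1 (by rw [hcard m, hp1 m htm])
  let q : ∀ m : Fin r, Fin (nI (is m)) := fun m => if h : tw m ≠ m then Classical.choose (hsing m h) else ⟨0, hn0 m⟩
  have hPq : ∀ m, tw m ≠ m → P m = {q m} := fun m htm => by
    have h := Classical.choose_spec (hsing m htm)
    simp only [q, dif_pos htm]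
    exact h
  have hread : ∀ m, tw m ≠ m → ∀ s : Kf (is m) →+* ℂ, s ∈ (Φ' m.succ).1 ↔ (e m s).2 = decide ((e m s).1 ∈ ({q m} : Finset (Fin (nI (is m))))) :=
    fun m htm s => by rw [← hPq m htm]; exact hΦ m s
  -- the partner's structure transported to the slot's own field, read at the partner's position
  have hpartner : ∀ m, tw m ≠ m → ∃ (Ψ₂ : CMType (Kf (is m))) (ι₂ : 𝓞 (Kf (is m)) →+* End (A (tw m).succ))
      (θ₂ : Kf (is m) →+* Module.End ℂ (complexBetti (A (tw m).succ).X 1)), IsCMTypeRealisation Ψ₂ (A (tw m).succ) ι₂ θ₂ ∧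
      (Finset.univ.filter fun s : Kf (is m) →+* ℂ => s.comp (im m) = τ ∧ s ∈ Ψ₂.1).card = 1 ∧
      ∀ s, s ∈ Ψ₂.1 ↔ (e m s).2 = decide ((e m s).1 ∈ ({Fin.cast (hn m) (q (tw m))} : Finset (Fin (nI (is m))))) := by
    intro m htm
    have htm' : tw (tw m) ≠ tw m := by rw [htw]; exact htm.symm
    obtain ⟨Ψ₂, ι₂, θ₂, hh₂, hA₂⟩ := castT _ _ (hι m) (Φ' (tw m).succ) (A (tw m).succ) (ι' (tw m).succ) (θ' (tw m).succ) (hA' (tw m).succ)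
    exact ⟨Ψ₂, ι₂, θ₂, hA₂, countT _ _ (hι m) (Φ' (tw m).succ) Ψ₂ hh₂ (h1 (tw m) htm'),
      readT _ _ (hι m).symm (hdeg m) (hdeg (tw m)) Ψ₂ (Φ' (tw m).succ) (Fin.cast (hn m) (q (tw m))) (q (tw m)) rfl hh₂.symm (hread (tw m) htm')⟩
  have hq : ∀ m, tw m ≠ m → Fin.cast (hn m) (q (tw m)) ≠ q m := by
    intro m htm hqq
    obtain ⟨Ψ₂, ι₂, θ₂, hA₂, -, hr₂⟩ := hpartner m htm
    rw [hqq] at hr₂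
    exact (DihedralSexticPair.cmType_ne_and_ne_compl_of_not_isIsogenous (hA' m.succ) hA₂ (hni m htm)).1
      (Set.ext fun s => (hread m htm s).trans (hr₂ s).symm)
  -- (5) the realised tuples are DIAGONAL on every pair and `2`-transitive there
  have hdg : ∀ π ∈ realisedTuples e τ, ∀ m, tw m ≠ m → ∀ a : Fin (nI (is (tw m))), Fin.cast (hn m) (π (tw m) a) = π m (Fin.cast (hn m) a) := by
    intro π hπ m _ a
    obtain ⟨ρ, -, hρ⟩ := (mem_realisedTuples e τ π).1 hπ
    exact diagT _ _ (hι m) (hdeg (tw m)) (hdeg m) (ρ : ℂ →+* ℂ) a (π (tw m) a) (π m (Fin.cast (hn m) a)) (hρ (tw m) a) (hρ m (Fin.cast (hn m) a))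
  -- the octic slots: `2`-transitive realised tuples (degree `24`)
  have h2T4 : ∀ m, nI (is m) = 4 → ∀ s₁ s₂ s₁' s₂' : Kf (is m) →+* ℂ, s₁.comp (im m) = τ → s₂.comp (im m) = τ → s₁'.comp (im m) = τ → s₂'.comp (im m) = τ →
      s₁ ≠ s₂ → s₁' ≠ s₂' → ∃ ρ : ℂ ≃+* ℂ, (ρ : ℂ →+* ℂ).comp τ = τ ∧ (ρ : ℂ →+* ℂ).comp s₁ = s₁' ∧ (ρ : ℂ →+* ℂ).comp s₂ = s₂' := fun m h4 =>
    h2T_of_finrank_pair_octic h2 im hdeg h24 m h4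
  have h2t4 : ∀ m, nI (is m) = 4 → ∀ a b a' b' : Fin (nI (is m)), a ≠ b → a' ≠ b' → ∃ π ∈ realisedTuples e τ, π m a = a' ∧ π m b = b' := fun m h4 =>
    twoTransitive_realisedTuples_of_aut (e := e) he_sign m (h2T4 m h4)
  -- the twin slots: octic by degree `24`, sextic by §1
  have h2t : ∀ m, tw m ≠ m → ∀ a a' b b' : Fin (nI (is m)), a ≠ a' → b ≠ b' → ∃ π ∈ realisedTuples e τ, π m a = b ∧ π m a' = b' := by
    intro m htm
    rcases htw34 m htm with h3 | h4
    · obtain ⟨Ψ₂, ι₂, θ₂, hA₂, hone₂, -⟩ := hpartner m htm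
      exact twoTransitive_realisedTuples_of_aut (e := e) he_sign m
        (twoTransitive_aut_of_sextic_twins (by rw [hdeg m, h3]) h2 (im m) τ (hA' m.succ) hA₂ (hS m (Or.inl h3))
          (hS (tw m) (Or.inl (by rw [hn]; exact h3))) (hni m htm) (h1 m htm) hone₂)
    · exact h2t4 m h4
  -- (6) stabiliser-transitivity across units: `Hom = ∅` within each degree (W1, the 𝔖₄ lemma, Y1), a value outside for octic → sextic, free otherwise
  have hout : ∀ m₀ m : Fin r, m₀ ≠ m → tw m₀ ≠ m → (nI (is m₀) = nI (is m) ∨ (nI (is m₀) = 4 ∧ nI (is m) = 3)) →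
      ∃ s : Kf (is m) →+* ℂ, s.comp (im m) = τ ∧ ∃ x, s x ∉ normalClosure ℚ (Kf (is m₀)) ℂ := by
    intro m₀ m h₁ h₂ hnm
    obtain ⟨s, hs⟩ := hexs m
    rcases hnm with heq | ⟨h4₀, h3⟩
    · rcases hnI m with h3 | h4 | h5
      · exact ⟨s, hs, exists_apply_not_mem_normalClosure_of_isEmpty_ringHom h2 im (by rw [hdeg m₀, heq, h3]) (by rw [hdeg m, h3]) (hiso m₀ m h₁ h₂ heq) s hs⟩
      · exact exists_outside_normalClosure_of_isEmpty_ringHom_four (n := fun l => nI (is l)) h2 hdeg im m₀ m (heq.trans h4) h4 (h2T4 m₀ (heq.trans h4))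
          (hiso m₀ m h₁ h₂ heq)
      · exact ⟨s, hs, exists_apply_not_mem_normalClosure_of_isEmpty_ringHom_five h2 im (by rw [hdeg m₀, heq, h5]) (by rw [hdeg m, h5]) (hiso m₀ m h₁ h₂ heq) s hs⟩
    · exact hout43 m₀ m h₁ h4₀ h3
  have hstab₀ : ∀ (m₀ m : Fin r), m₀ ≠ m → tw m₀ ≠ m → ∀ a a' : Fin (nI (is m)), ∃ ν ∈ realisedTuples e τ, ν m₀ = 1 ∧ ν m a = a' := by
    intro m₀ m h₁ h₂ a a'
    rcases hnI m with h3 | h4 | h5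
    · rcases hnI m₀ with h3₀ | h4₀ | h5₀
      · exact stabTransitive_realisedTuples_of_outside_prime (e := e) he_sign m₀ m (by rw [h3]; exact Nat.prime_three) (hout m₀ m h₁ h₂ (Or.inl (h3₀.trans h3.symm))) a a'
      · exact stabTransitive_realisedTuples_of_outside_prime (e := e) he_sign m₀ m (by rw [h3]; exact Nat.prime_three) (hout m₀ m h₁ h₂ (Or.inr ⟨h4₀, h3⟩)) a a'
      · exact stabTransitive_realisedTuples_of_sizes_three_five (e := e) he_sign m₀ m (Or.inl ⟨h5₀, h3⟩) a a'
    · rcases hnI m₀ with h3₀ | h4₀ | h5₀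
      · exact stabTransitive_realisedTuples_into_four (e := e) he_sign m₀ m (Or.inl h3₀) h4 (h2t4 m h4) a a'
      · exact stabTransitive_realisedTuples_of_outside_twoTransitive (e := e) he_sign m₀ m (h2t4 m h4) (hout m₀ m h₁ h₂ (Or.inl (h4₀.trans h4.symm))) a a'
      · exact stabTransitive_realisedTuples_into_four (e := e) he_sign m₀ m (Or.inr h5₀) h4 (h2t4 m h4) a a'
    · rcases hnI m₀ with h3₀ | h4₀ | h5₀
      · exact stabTransitive_realisedTuples_of_sizes_three_five (e := e) he_sign m₀ m (Or.inr ⟨h3₀, h5⟩) a a'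
      · exact stabTransitive_realisedTuples_into_five_of_four (e := e) he_sign m₀ m h4₀ h5 a a'
      · exact stabTransitive_realisedTuples_of_outside_prime (e := e) he_sign m₀ m (by rw [h5]; exact Nat.prime_five) (hout m₀ m h₁ h₂ (Or.inl (h5₀.trans h5.symm))) a a'
  have hstab : ∀ (m₀ m : Fin r), m₀ ≠ m → tw m₀ ≠ m → ∀ a a' : Fin (nI (is m)), ∃ ν ∈ realisedTuples e τ, ν m₀ = 1 ∧ ν (tw m₀) = 1 ∧ ν m a = a' := by
    intro m₀ m h₁ h₂ a a'
    obtain ⟨ν, hν, hν0, hνa⟩ := hstab₀ m₀ m h₁ h₂ a a'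
    refine ⟨ν, hν, hν0, ?_, hνa⟩
    by_cases ht : tw m₀ = m₀
    · rw [ht]; exact hν0
    · ext b
      have hb := hdg ν hν m₀ ht b
      rw [hν0, Equiv.Perm.one_apply] at hb
      have hb' := congrArg Fin.val hb
      rw [Fin.val_cast, Fin.val_cast] at hb'
      exact hb'
  -- (7) the slot menu on the single slots
  have hkind : ∀ m : Fin r, tw m = m → (nI (is m)).Prime ∨ p m = 1 ∨ ∀ Q : Finset (Fin (nI (is m))), Q.card = p m → ∃ π ∈ realisedTuples e τ, preG (π m) (P m) = Q := by
    intro m _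
    rcases hnp m with ⟨h, -⟩ | ⟨-, h'⟩ | ⟨h, h'⟩ | ⟨h, -⟩
    · exact Or.inl (by rw [h]; exact Nat.prime_three)
    · exact Or.inr (Or.inl h')
    · have hhom := homogeneous_two_of_twoTransitive (R := realisedTuples e τ) (P := P) (m := m) (by rw [hcard m, h']) (h2t4 m h)
      exact Or.inr (Or.inr fun Q hQ => hhom Q (by rw [hQ, hcard m]))
    · exact Or.inl (by rw [h]; exact Nat.prime_five)
  -- (8) the engine with several twin pairs and the slot menu; the single-slot Weil spaces from Markman's theorems
  exact hodgeConjectureFor_biproduct_comp_of_twins_kind_frames (is := is) (n := fun m => nI (is m)) P p hcard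
    (fun m => by rcases hnp m with ⟨-, h⟩ | ⟨-, h⟩ | ⟨-, h⟩ | ⟨-, h⟩ <;> rw [h] <;> norm_num)
    (fun m => by rcases hnp m with ⟨h, h'⟩ | ⟨h, h'⟩ | ⟨h, h'⟩ | ⟨h, h'⟩ <;> rw [h, h'] <;> norm_num)
    κ h2 im hτ hA' e he_sign he_conj hΨ' hΦ tw htw hn (fun m htm => by rcases htw34 m htm with h | h <;> omega)
    (fun π hπ m htm a => hdg π hπ m htm a) h2t hstab q hPq hq hkind
    fun m => weilHyp_of_markman_intrinsic hW4 hM6 m (hnp m) (hdeg m) h2 hd hδ hA' hΨ' (hp m)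

/-- **Dominated form.** [cite: Markman2025SurveySecant, Thm. 1.2] [cite: Markman2025SecantWeil, Thm 1.5.1] [cite: MumfordAV1970, §19] -/
theorem hodgeConjectureFor_of_avDominatedBy_comp_of_twinsMenu_octic (hW4 : Markman2025_weilClasses_algebraic_abelianFourfold)
    (hM6 : Markman2025_weilClasses_algebraic_hyperbolicSixfold) {N : ℕ} (κ : Fin N → Fin (r + 1)) (h2 : Module.finrank ℚ (Kf i₀) = 2) (nI : I → ℕ)
    (hnI : ∀ m : Fin r, nI (is m) = 3 ∨ nI (is m) = 4 ∨ nI (is m) = 5) (hdeg : ∀ m : Fin r, Module.finrank ℚ (Kf (is m)) = 2 * nI (is m))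
    (iK : ∀ i : I, Kf i₀ →+* Kf i) (hA : ∀ j, IsCMTypeRealisation (Φ j) (A j) (ι j) (θ j)) (hΨ : ∀ σ : Kf i₀ →+* ℂ, σ ∈ (Φ 0).1 ↔ σ = τ)
    (tw : Fin r → Fin r) (htw : ∀ m, tw (tw m) = m) (hι : ∀ m, is (tw m) = is m) (htw34 : ∀ m, tw m ≠ m → nI (is m) = 3 ∨ nI (is m) = 4)
    (hS : ∀ m : Fin r, nI (is m) = 3 ∨ nI (is m) = 4 → (A m.succ).IsSimple)
    (h23 : ∀ m : Fin r, nI (is m) = 5 → (Finset.univ.filter fun s : Kf (is m) →+* ℂ => s.comp (iK (is m)) = τ ∧ s ∈ (Φ m.succ).1).card = 2 ∨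
      (Finset.univ.filter fun s : Kf (is m) →+* ℂ => s.comp (iK (is m)) = τ ∧ s ∈ (Φ m.succ).1).card = 3)
    (h13 : ∀ m : Fin r, tw m ≠ m → nI (is m) = 4 → (Finset.univ.filter fun s : Kf (is m) →+* ℂ => s.comp (iK (is m)) = τ ∧ s ∈ (Φ m.succ).1).card = 1 ∨
      (Finset.univ.filter fun s : Kf (is m) →+* ℂ => s.comp (iK (is m)) = τ ∧ s ∈ (Φ m.succ).1).card = 3)
    (hni : ∀ m, tw m ≠ m → ¬ AbelianVariety.IsIsogenous (A m.succ) (A (tw m).succ))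
    (h24 : ∀ m : Fin r, nI (is m) = 4 → ∃ s₀ t₀ : Kf (is m) →+* ℂ, s₀.comp (iK (is m)) = τ ∧ t₀.comp (iK (is m)) = τ ∧ s₀ ≠ t₀ ∧
      Module.finrank ℚ ↥(adjoin ℚ (Set.range τ) ⊔ adjoin ℚ (Set.range s₀ ∪ Set.range t₀)) = 24)
    (hiso : ∀ m₀ m : Fin r, m₀ ≠ m → tw m₀ ≠ m → nI (is m₀) = nI (is m) → IsEmpty (Kf (is m) →+* Kf (is m₀)))
    (hout43 : ∀ m₀ m : Fin r, m₀ ≠ m → nI (is m₀) = 4 → nI (is m) = 3 →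
      ∃ s : Kf (is m) →+* ℂ, s.comp (iK (is m)) = τ ∧ ∃ x, s x ∉ normalClosure ℚ (Kf (is m₀)) ℂ)
    {X : AbelianVariety ℂ} (hX : Domination.AVDominatedBy X (⨁ fun j => A (κ j))) : HodgeConjectureFor X.dim X.X :=
  Domination.hodgeConjectureFor_of_avDominatedBy
    (hodgeConjectureFor_biproduct_comp_of_twinsMenu_octic hW4 hM6 κ h2 nI hnI hdeg iK hA hΨ tw htw hι htw34 hS h23 h13 hni h24 hiso hout43) hX

end TwinsMenu

end Summit.HodgeConjecture.CorCM.MultiFieldWeil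

end
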